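import Summits.BirchSwinnertonDyer.BirchSwinnertonDyer.Theorems.SignedLowerHalvesKobayashiMainConjectureSmallImageAnalyticTransfer
import Summits.BirchSwinnertonDyer.BirchSwinnertonDyer.Theorems.SignedLowerHalvesKobayashiMainConjectureSmallImageLambdaTransferCM
import HarnessLib

/-!
# Route `SignedLowerHalves`, crux `KobayashiMainConjectureSmallImage` (item stmt-BirchSwinnertonDyer-19002):
# the ANALYTIC-TRANSFER ROAD at small image («L4-AN», part 2 of 2) — Greenberg–Vatsal at a supersingular prime
# with BOTH sides transferred in the kernel: Kobayashi's signed main conjecture for `(E, p, ε)` at a pair of ANY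
# image from a `p`-congruent partner's main conjecture + `μ = 0` and ONE displayed Mazur–Tate congruence
# (cell `bsd-ssimc`, seat `bsd-ssimc-k3-c4` gen 7; a `--supports stmt-BirchSwinnertonDyer-19002 --as helper` file)

PARTITION (cell bsd-ssimc): X7 (A7) × item 4's non-surjective `a_p = 0` window pairs WITH a `p`-congruent
partner (79 CM-EC-partnered + 7 unit-partnered), ALL ranks — types-the-object-of (a per-pair road with NO
E-side certificate); the crux stays OPEN (`stub_lowerSmallImage` has no engine); closes none; nothing booked;
BSD is not proved by any of this. THEOREMS ONLY: no definition, no named fact, nothing about any curve asserted.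

## The road (§3) and its partner forms (§4)

Fix `E = W`, `E′ = W′` (globally minimal), `p` odd good for both with `a_p = 0`, a `Γ_ℚ`-iso `E[p] ≃ E′[p]`
(`he`), a sign `ε`, a finite `S₀ ∌ p` containing the bad places of both, the conductor-level newforms `f₀`,
`f₀′`, a unit `c` and the displayed congruence `hMT` of the `S₀`-depleted Mazur–Tate elements (part 1,
`…SmallImageAnalyticTransfer.lean`, whose module docstring records its printed status: Corpuz–Lei 2025
Prop. 4.2, PRE, published ingredients in scope; Vatsal 1999 not held). NO hypothesis on the image of `ρ̄_{E,p}`.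
* `kobayashiMainConjecture_of_mazurTate_congr_of_mainConjecture`: partner hypotheses
  `KobayashiMainConjecture W′ p ε` (`hMC′`) and `μ(L^ε_p(E′)) = 0` (`hμ′`) ⇒ `(μ, λ)(X^ε(E′)) = (0, λ(L^ε_p(E′)))`
  (`ϖ′ ∈ ℤ_pˣ` by `h5`/`h3`); B. D. Kim 2009 Cor. 2.13 μ-half (`h09`) ⇒ `μ(X^ε(E)) = 0`, so a generator `ξ` of
  `char X^ε(E)` has unit content and Kobayashi Thm. 4.1's RATIONAL clause (`h41`, no image hypothesis) +
  Gauss (`signedUpper_dvd_of_hasUnitContent`, g4) ⇒ `ξ ∣ L^ε_p(E)`; Kim's λ-half (`hKim`) and part 1 §2 ⇒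
  `λ(ξ) = λ(X^ε(E)) = λ(L^ε_p(E′)) + Σδ_{E′} − Σδ_E = λ(L^ε_p(E))`, `μ(L^ε_p(E)) = 0` ⇒ `(ξ) = (L^ε_p(E))`;
  `ϖ ∈ ℤ_pˣ` ⇒ `KobayashiMainConjecture W p ε` VERBATIM. = Greenberg–Vatsal's Thm. (1.4) at a SUPERSINGULAR
  prime, signed, in the kernel modulo `hMT`: NO E-side certificate, NO `Surj`, NO `BSD(E,p)`, NO rank
  hypothesis, NO preprint binder (the Corpuz–Lei binder of L4-CM, p422273, and the E-side two-engine
  certificate `hcert₀` + bookkeeping `hδ` of L4-λ, p473173, are all replaced by `hMT`).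
* §4 `…_of_cmPartner` (`hMC′` = Pollack–Rubin 2004 by name), `mu_signed_eq_zero_of_lvalue` (`hμ′` from ONE
  `L`-value, Kurihara's unit case, g2's `hasUnitContent_kobayashiL_of_lvalue`), `…_of_cmPartner_of_lvalue`.

## What this is NOT

Not a class theorem about the crux (partner and `hMT` are per pair); not a proof of `hMT`; PER PAIR roads,
CONDITIONAL on displayed hypotheses; nothing booked; BSD is not proved by any of this.

References: [GreenbergVatsal2000] Thm. (1.4), §3 Rem. 3.4; [Kobayashi2003] Thm. 1.2, Thm. 4.1 (p. 8),
(3.4)–(3.6), Conjecture (p. 2); [BDKim2009] Cor. 2.13, Cor. 2.5, Prop. 2.6; [PollackRubin2004] Thm. (p. 448);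
[Kurihara2002] Thm. 0.1; [CorpuzLei2025] Prop. 4.2, Thm. 5.10 (PRE); [Washington1997] §7.1, §13.2.
Memo: `HOME/k3c4-MEMO-7.md` (cell bsd-ssimc).
-/

set_option autoImplicit false
set_option linter.dupNamespace false
noncomputable section

open scoped Classical MatrixGroups ModularForm BigOperators

open CongruenceSubgroup WeierstrassCurve NumberField IsDedekindDomain
  Literature.NumberTheory.EllipticCurves
  Literature.NumberTheory.EllipticCurves.ModularForms
  Literature.NumberTheory.EllipticCurves.Rank1Residual
  Literature.NumberTheory.EllipticCurves.Rank1Residual.Typed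
  Literature.NumberTheory.EllipticCurves.Kobayashi2003 ZpExtension
  Literature.NumberTheory.EllipticCurves.GreenbergVatsal2000
  Literature.NumberTheory.EllipticCurves.BDKim2009
  Literature.NumberTheory.EllipticCurves.Sprung2017
  Summit.BirchSwinnertonDyer.Rank1Residual.X1.MuLambda
  Summit.BirchSwinnertonDyer.Rank1Residual.X11a
  Summit.BirchSwinnertonDyer.Rank1Residual.Supersingular
  Summit.BirchSwinnertonDyer.BirchSwinnertonDyer.Theorems.SmallImageAnalyticTransfer

namespace Summit.BirchSwinnertonDyer.BirchSwinnertonDyer.Theorems.SmallImageAnalyticTransferRoad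

variable {p : ℕ} [hp : Fact p.Prime]

/-! ### §3 The road: Kobayashi's main conjecture from a congruent partner's main conjecture + `μ = 0` -/

/-- **Greenberg–Vatsal at a supersingular prime, both sides in the kernel (modulo `hMT`): Kobayashi's main
conjecture for `(E, p, ε)` AT THE PAIR, any image, any rank, from a `p`-congruent partner satisfying its own
main conjecture with `μ = 0`.** Inputs BY NAME: Kobayashi 2003 Thm. 1.2 (`h12`), Thm. 4.1 RATIONAL clause
(`h41`; NO image hypothesis), the period-unit facts (`h5`, `h3`), B. D. Kim 2009 Cor. 2.13 μ-half (`h09`) and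
λ-half ∘ Cor. 2.5 ∘ Prop. 2.6 (`hKim`), modularity (`hmod`, for the partner's period ratio); per-pair DATA:
`p` odd, `E = W` and `E′ = W′` good at `p` with `a_p = 0`, `W[p] ≃ W′[p]` (`he`), conductor-level newforms
`f₀`, `f₀′`, a finite `S₀ ∌ p` containing the bad places of both, a unit `c ∈ ℤ_p`, the displayed Mazur–Tate
congruence `hMT` (module docstring); partner HYPOTHESES: `KobayashiMainConjecture W′ p ε` (`hMC′`; for a
CM partner Pollack–Rubin 2004 by name, §4) and `μ(L^ε_p(E′)) = 0` (`hμ′`, a certificate or Kurihara's unit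
case). Conclusion: `KobayashiMainConjecture W p ε` VERBATIM. Chain: `hMC′` + `hμ′` ⇒
`(μ, λ)(X^ε(E′)) = (0, λ(L^ε_p(E′)))`; `h09` ⇒ `μ(X^ε(E)) = 0`; `h41` + Gauss ⇒ `ξ ∣ L^ε_p(E)` for a
generator `ξ` of `char X^ε(E)`; `hKim` and §2 ⇒ `λ(ξ) = λ(L^ε_p(E))`, `μ(L^ε_p(E)) = 0` ⇒ `(ξ) = (L^ε_p(E))`;
`ϖ ∈ ℤ_pˣ`. NO E-side certificate, NO `Surj`, NO `BSD(E,p)`, NO rank, NO preprint binder. PER PAIR;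
CONDITIONAL on `hMT`; NOT a class theorem about the crux; closes nothing.
[cite: GreenbergVatsal2000, Thm. (1.4), §1 (8)–(9) and §3 Remark 3.4] [cite: Kobayashi2003, Thm. 1.2, Thm. 4.1 (p. 8) and Conjecture (p. 2)]
[cite: BDKim2009, Cor. 2.13, Cor. 2.5 and Prop. 2.6 (pp. 185–187)] [cite: Washington1997, §13.2 and §7.1] -/
theorem kobayashiMainConjecture_of_mazurTate_congr_of_mainConjecture
    {W : WeierstrassCurve ℚ} [W.IsElliptic] [W.IsGloballyMinimal]
    (h12 : Kobayashi2003.thm12_signedSelmerDual_finite_torsion)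
    (h41 : Kobayashi2003.thm41_signedCharIdeal_divisibility)
    (h5 : realPeriodRat_eq_unit_mul_plusPeriod) (h3 : realPeriodRat_eq_unit_mul_plusPeriod_three)
    (h09 : cor213_signedMu_eq_zero_iff_of_torsionIso)
    (hKim : BDKim2009.cor213_signedLambda_add_sum_delta_eq_of_torsionIso)
    (hmod : nonempty_modularParametrizationData)
    (hp2 : p ≠ 2) (hgood : W.HasGoodReductionAtPrime p) (hap : W.frobeniusTrace p = 0) (ε : ℤˣ)
    [NeZero (W.conductorNorm ℤ)] {f₀ : CuspForm (Gamma0 (W.conductorNorm ℤ)) 2} (hf₀ : IsNewformOf W f₀)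
    {W' : WeierstrassCurve ℚ} [W'.IsElliptic] [W'.IsGloballyMinimal]
    (hgood' : W'.HasGoodReductionAtPrime p) (hap' : W'.frobeniusTrace p = 0)
    (he : ∃ e : geomTorsion W (p : ℤ) ≃+ geomTorsion W' (p : ℤ),
      ∀ (σ : Field.absoluteGaloisGroup ℚ) (P : geomTorsion W (p : ℤ)), e (σ • P) = σ • e P)
    [NeZero (W'.conductorNorm ℤ)] {f₀' : CuspForm (Gamma0 (W'.conductorNorm ℤ)) 2}
    (hf₀' : IsNewformOf W' f₀')
    (hMC' : KobayashiMainConjecture W' p ε)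
    (hμ' : ∀ L' : IwasawaAlgebra p, IsSignedPAdicLFunction f₀' p ε L' → mu L' = 0)
    (S₀ : Finset (HeightOneSpectrum (𝓞 ℚ))) (hS₀ : ∀ v ∈ S₀, ((p : ℕ) : 𝓞 ℚ) ∉ v.asIdeal)
    (hS₀W : ∀ v : HeightOneSpectrum (𝓞 ℚ), ¬ W.HasGoodReductionAt v → v ∈ S₀)
    (hS₀W' : ∀ v : HeightOneSpectrum (𝓞 ℚ), ¬ W'.HasGoodReductionAt v → v ∈ S₀)
    {c : ℤ_[p]} (hc : IsUnit c)
    (hMT : ∀ n : ℕ, ∃ q r : IwasawaAlgebra p,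
      ((mazurTateElement f₀ p n).map (algebraMap ℚ ℚ_[p]) : PowerSeries ℚ_[p]) *
            iwasawaToPowerSeries p (eulerFactorProduct W p S₀) -
          iwasawaToPowerSeries p (PowerSeries.C c) *
            (((mazurTateElement f₀' p n).map (algebraMap ℚ ℚ_[p]) : PowerSeries ℚ_[p]) *
              iwasawaToPowerSeries p (eulerFactorProduct W' p S₀)) =
        iwasawaToPowerSeries p
          (toIwasawa p (cyclotomicOmega p n) * q + PowerSeries.C (p : ℤ_[p]) * r)) :
    KobayashiMainConjecture W p ε := by
  intro κ γ hκ hγ hγ' _ f hf ϖ hϖ Lplus Lminus hPP D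
  -- the newform of the quantifier is `f₀`
  have hff : f = f₀ := hf.unique hf₀
  subst hff
  -- Thm. 1.2: `X^ε(E)` finitely generated and torsion
  haveI : Module.Finite (IwasawaAlgebra p) D.X := h12.moduleFinite hp2 hgood hap hκ hγ D
  have hX : Module.IsTorsion (IwasawaAlgebra p) D.X := h12.isTorsion hp2 hgood hap hκ hγ D
  refine ⟨hX, ?_⟩
  -- a generator `ξ` of `Char(X^ε(E))` and Kobayashi's `L^ε_p(E)`
  obtain ⟨ξ, hξ⟩ := (charIdeal_isPrincipal_holds p D.X).principal
  have hξ' : D.charIdeal = Ideal.span {ξ} := hξ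
  set L := kobayashiL ε Lplus Lminus with hL_def
  have hL : IsSignedPAdicLFunction f p ε L := hPP.isSignedPAdicLFunction_kobayashiL ε
  have hL0 : L ≠ 0 := by
    rw [hL_def]
    unfold kobayashiL
    split_ifs
    · exact hPP.2.1
    · exact hPP.1
  -- the partner's Pollack pair and `L^ε_p(E′)`
  obtain ⟨Lplus', Lminus', hPP'⟩ :=
    exists_isPollackPair (W := W') pollack_exists_plusMinusPAdicLFunction_holds hp2 hf₀' hgood' hap'
  set L' := kobayashiL ε Lplus' Lminus' with hL'_def
  have hL' : IsSignedPAdicLFunction f₀' p ε L' := hPP'.isSignedPAdicLFunction_kobayashiL ε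
  have hL'0 : L' ≠ 0 := by
    rw [hL'_def]
    unfold kobayashiL
    split_ifs
    · exact hPP'.2.1
    · exact hPP'.1
  have hμL' : mu L' = 0 := hμ' L' hL'
  -- the partner's period ratio `ϖ′` (modularity), a `p`-adic unit
  obtain ⟨Dm⟩ := hmod W'
  have hffm : Dm.f = f₀' := Dm.isNewformOf.unique hf₀'
  obtain ⟨ϖ', hϖpos, hϖ', -⟩ := Dm.exists_rat_mul_realPeriodRat_eq_plusPeriod
  rw [hffm] at hϖ'
  -- the partner's datum `D′` and its main conjecture: `char X^ε(E′) = (L′)`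
  obtain ⟨D'⟩ := nonempty_signedSelmerDualData W' κ ε hγ
  haveI : Module.Finite (IwasawaAlgebra p) D'.X := h12.moduleFinite hp2 hgood' hap' hκ hγ D'
  have hX' : Module.IsTorsion (IwasawaAlgebra p) D'.X := h12.isTorsion hp2 hgood' hap' hκ hγ D'
  obtain ⟨-, g', hg', hι'⟩ := hMC' κ γ hκ hγ hγ' f₀' hf₀' ϖ' hϖ' Lplus' Lminus' hPP' D'
  have hirr' : W'.HasIrreducibleModPGaloisRep p :=
    hasIrreducibleModPGaloisRep_of_dvd_frobeniusTrace W' p hp2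
      (W'.not_dvd_minimalDiscriminantInt_of_hasGoodReductionAtPrime' p hgood')
      (by rw [hap']; exact dvd_zero _)
  have hvϖ' : padicValRat p ϖ' = 0 :=
    padicValRat_periodRatio_eq_zero h5 h3 W' p hp2 hgood' hirr' f₀' hf₀' ϖ' hϖ'
  obtain ⟨u', hu'⟩ := exists_units_coe_eq_ratCast hϖpos.ne' hvϖ'
  obtain ⟨hspanu', hιu'⟩ := span_C_units_mul_eq u' L'
  have hgeq : g' = PowerSeries.C (u' : ℤ_[p]) * L' :=
    iwasawaToPowerSeries_injective p (by rw [hι', hιu', hu'])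
  have hgL' : D'.charIdeal = Ideal.span {L'} := by rw [hg', hgeq, hspanu']
  -- hence `(μ, λ)(X^ε(E′)) = (0, λ(L′))`
  have hμD' : muInvariant p D'.X = 0 := by
    rw [← Summit.BirchSwinnertonDyer.Rank1Residual.X1.MuPart.mu_generator_eq_muInvariant D'.X hX' hL'0 hgL']
    exact hμL'
  have hlamD' : lambdaInvariant p D'.X = lam L' :=
    (Summit.BirchSwinnertonDyer.Rank1Residual.X1.ParitySqueeze.lam_generator_eq_lambdaInvariant D'.X hX'
      hL'0 hgL').symm
  -- B. D. Kim 2009, μ-half: `μ(X^ε(E)) = 0`, i.e. `ξ` has unit content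
  have hDmu : D.mu = 0 := (h09 W W' p hp2 hgood hap hgood' hap' he κ γ hκ hγ ε D D' hX hX').mpr hμD'
  have hu : HasUnitContent ξ := (muInvariant_eq_zero_iff_hasUnitContent D.X hX hξ').mp hDmu
  -- Kobayashi Thm. 4.1 (rational) + Gauss: `ξ ∣ L` with NO image hypothesis
  have hU : ξ ∣ L := signedUpper_dvd_of_hasUnitContent h41 hp2 hgood hap hf hκ hγ hγ' hL D hX hξ' hu
  obtain ⟨h, hfac⟩ := hU
  have hξ0 : ξ ≠ 0 := by
    rintro rfl
    exact hL0 (by rw [hfac, zero_mul])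
  -- B. D. Kim 2009, λ-half (algebraic transfer) and §2 (analytic transfer): `λ(X^ε(E)) = λ(L)`
  have hT := hKim W W' p hp2 hgood hap hgood' hap' he κ γ hκ hγ S₀ hS₀ hS₀W hS₀W' ε D D' hX hX' hDmu
  obtain ⟨hμL, hA⟩ := mu_eq_zero_and_lam_add_sum_delta_eq_of_mazurTate_congr hp2 hgood hap hgood' hap'
    hf hf₀' S₀ hS₀ hc hMT ε hL hL' hμL'
  have hlamξ : lam ξ = lam L := by
    rw [Summit.BirchSwinnertonDyer.Rank1Residual.X1.ParitySqueeze.lam_generator_eq_lambdaInvariant D.X hX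
      hξ0 hξ]
    rw [hlamD'] at hT
    omega
  -- the squeeze: `(ξ) = (L)`
  have hspan : Ideal.span ({ξ} : Set (IwasawaAlgebra p)) = Ideal.span {L} :=
    ((span_eq_span_iff_mu_le_and_lam_le hξ0 hL0 hfac).mpr
      ⟨by rw [hμL]; exact Nat.zero_le _, by rw [hlamξ]⟩).symm
  -- the period ratio `ϖ` of `E` is a `p`-adic unit
  have hirr : W.HasIrreducibleModPGaloisRep p :=
    hasIrreducibleModPGaloisRep_of_dvd_frobeniusTrace W p hp2
      (W.not_dvd_minimalDiscriminantInt_of_hasGoodReductionAtPrime' p hgood) (by rw [hap]; exact dvd_zero _)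
  have hvϖ : padicValRat p ϖ = 0 := padicValRat_periodRatio_eq_zero h5 h3 W p hp2 hgood hirr f hf ϖ hϖ
  have hϖ0 : ϖ ≠ 0 := by
    intro h0
    rw [h0, Rat.cast_zero, zero_mul] at hϖ
    exact (IsNewform0.plusPeriod_pos_holds hf.1 hf.coeffField_eq_bot).ne' hϖ.symm
  obtain ⟨u, hu''⟩ := exists_units_coe_eq_ratCast hϖ0 hvϖ
  obtain ⟨hspan', hι⟩ := span_C_units_mul_eq u L
  refine ⟨PowerSeries.C (u : ℤ_[p]) * L, ?_, ?_⟩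
  · rw [hξ', hspan, hspan']
  · rw [hι, hu'']

/-! ### §4 Partner forms -/

/-- **CM-partner form.** `E′ = W′` with complex multiplication, good supersingular at the odd `p` with
`a_p(E′) = 0`: its main conjecture is Pollack–Rubin 2004 (`hPR`, by name:
`kobayashiMainConjecture_of_pollackRubin_of_goodSS`); the partner's analytic `μ(L^ε_p(E′)) = 0` stays a
displayed hypothesis `hμ′` (a two-engine Mazur–Tate certificate read by `lam_signed_neg_one/one_eq_of_mazurTate'`,
or Kurihara's unit case `hasUnitContent_kobayashiL_of_lvalue` from one `L`-value). With `hMT`: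
`KobayashiMainConjecture W p ε` for the congruent curve `E = W` of ANY image — the Corpuz–Lei binder of
L4-CM (p422273) and the E-side certificate of L4-λ (p473173) both replaced by `hMT`. PER PAIR; CONDITIONAL
on `hMT`; closes nothing. [cite: PollackRubin2004, Theorem (p. 448) = Thm. 7.3]
[cite: GreenbergVatsal2000, Thm. (1.4) and §3 Remark 3.4] [cite: Kobayashi2003, Thm. 4.1 (p. 8) and Conjecture (p. 2)]
[cite: BDKim2009, Cor. 2.13, Cor. 2.5 and Prop. 2.6 (pp. 185–187)] -/
theorem kobayashiMainConjecture_of_mazurTate_congr_of_cmPartner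
    {W : WeierstrassCurve ℚ} [W.IsElliptic] [W.IsGloballyMinimal]
    (h12 : Kobayashi2003.thm12_signedSelmerDual_finite_torsion)
    (h41 : Kobayashi2003.thm41_signedCharIdeal_divisibility)
    (h5 : realPeriodRat_eq_unit_mul_plusPeriod) (h3 : realPeriodRat_eq_unit_mul_plusPeriod_three)
    (h09 : cor213_signedMu_eq_zero_iff_of_torsionIso)
    (hKim : BDKim2009.cor213_signedLambda_add_sum_delta_eq_of_torsionIso)
    (hPR : PollackRubin2004.mainTheorem_signedCharIdeal_eq_of_cm)
    (hmod : nonempty_modularParametrizationData)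
    (hp2 : p ≠ 2) (hgood : W.HasGoodReductionAtPrime p) (hap : W.frobeniusTrace p = 0) (ε : ℤˣ)
    [NeZero (W.conductorNorm ℤ)] {f₀ : CuspForm (Gamma0 (W.conductorNorm ℤ)) 2} (hf₀ : IsNewformOf W f₀)
    {W' : WeierstrassCurve ℚ} [W'.IsElliptic] [W'.IsGloballyMinimal]
    (hcm' : W'.HasCM) (hss' : GoodSS W' p) (hap' : W'.frobeniusTrace p = 0)
    (he : ∃ e : geomTorsion W (p : ℤ) ≃+ geomTorsion W' (p : ℤ),
      ∀ (σ : Field.absoluteGaloisGroup ℚ) (P : geomTorsion W (p : ℤ)), e (σ • P) = σ • e P)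
    [NeZero (W'.conductorNorm ℤ)] {f₀' : CuspForm (Gamma0 (W'.conductorNorm ℤ)) 2}
    (hf₀' : IsNewformOf W' f₀')
    (hμ' : ∀ L' : IwasawaAlgebra p, IsSignedPAdicLFunction f₀' p ε L' → mu L' = 0)
    (S₀ : Finset (HeightOneSpectrum (𝓞 ℚ))) (hS₀ : ∀ v ∈ S₀, ((p : ℕ) : 𝓞 ℚ) ∉ v.asIdeal)
    (hS₀W : ∀ v : HeightOneSpectrum (𝓞 ℚ), ¬ W.HasGoodReductionAt v → v ∈ S₀)
    (hS₀W' : ∀ v : HeightOneSpectrum (𝓞 ℚ), ¬ W'.HasGoodReductionAt v → v ∈ S₀)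
    {c : ℤ_[p]} (hc : IsUnit c)
    (hMT : ∀ n : ℕ, ∃ q r : IwasawaAlgebra p,
      ((mazurTateElement f₀ p n).map (algebraMap ℚ ℚ_[p]) : PowerSeries ℚ_[p]) *
            iwasawaToPowerSeries p (eulerFactorProduct W p S₀) -
          iwasawaToPowerSeries p (PowerSeries.C c) *
            (((mazurTateElement f₀' p n).map (algebraMap ℚ ℚ_[p]) : PowerSeries ℚ_[p]) *
              iwasawaToPowerSeries p (eulerFactorProduct W' p S₀)) =
        iwasawaToPowerSeries p
          (toIwasawa p (cyclotomicOmega p n) * q + PowerSeries.C (p : ℤ_[p]) * r)) :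
    KobayashiMainConjecture W p ε :=
  kobayashiMainConjecture_of_mazurTate_congr_of_mainConjecture h12 h41 h5 h3 h09 hKim hmod hp2 hgood hap ε
    hf₀ hss'.1 hap' he hf₀' (kobayashiMainConjecture_of_pollackRubin_of_goodSS W' p hPR hcm' hp2 hss' ε) hμ'
    S₀ hS₀ hS₀W hS₀W' hc hMT

/-- **Partner's `μ(L^ε_p(E′)) = 0` from ONE `L`-value (Kurihara's unit case): if `L(E′,1)/Ω(E′) = q` with
`q ≠ 0`, `ord_p q = 0`, then every signed `L^ε_p` of the partner's newform has `μ = 0`** — the `hμ′` of §3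
for a rank-`0` partner in the unit zone (CM or not), read off the tree's `hasUnitContent_kobayashiL_of_lvalue`
(period-unit facts `h5`/`h3` by name). [cite: Kurihara2002, Thm. 0.1] [cite: Kobayashi2003, (3.6) (p. 7)]
[cite: GreenbergVatsal2000, p. 2 (2) and §3 Remark 3.4] -/
theorem mu_signed_eq_zero_of_lvalue {W' : WeierstrassCurve ℚ} [W'.IsElliptic] [W'.IsGloballyMinimal]
    (h5 : realPeriodRat_eq_unit_mul_plusPeriod) (h3 : realPeriodRat_eq_unit_mul_plusPeriod_three)
    (hp2 : p ≠ 2) (hgood' : W'.HasGoodReductionAtPrime p) (hap' : W'.frobeniusTrace p = 0) {q : ℚ}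
    (hq0 : q ≠ 0) (hLval : W'.entireLFunction 1 / (W'.realPeriodRat : ℂ) = (q : ℂ))
    (hv : padicValRat p q = 0) [NeZero (W'.conductorNorm ℤ)]
    {f₀' : CuspForm (Gamma0 (W'.conductorNorm ℤ)) 2} (hf₀' : IsNewformOf W' f₀') (ε : ℤˣ) :
    ∀ L' : IwasawaAlgebra p, IsSignedPAdicLFunction f₀' p ε L' → mu L' = 0 := by
  intro L' hL'
  obtain ⟨Lplus', Lminus', hPP'⟩ :=
    exists_isPollackPair (W := W') pollack_exists_plusMinusPAdicLFunction_holds hp2 hf₀' hgood' hap'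
  have hU : HasUnitContent (kobayashiL ε Lplus' Lminus') :=
    hasUnitContent_kobayashiL_of_lvalue W' p h5 h3 hp2 hgood' hap' hq0 hLval hv f₀' hf₀' Lplus' Lminus' hPP' ε
  have hLeq : L' = kobayashiL ε Lplus' Lminus' := hL'.unique (hPP'.isSignedPAdicLFunction_kobayashiL ε)
  rw [hLeq]
  exact mu_eq_zero_of_hasUnitContent hU

/-- **CM partner in the unit zone (rank `0`, ONE `L`-value): the road with `hμ′` discharged.** As
`kobayashiMainConjecture_of_mazurTate_congr_of_cmPartner`, the partner's `μ(L^ε_p(E′)) = 0` read off the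
certificate `L(E′,1)/Ω(E′) = q`, `q ≠ 0`, `ord_p q = 0` (`mu_signed_eq_zero_of_lvalue`). Remaining displayed
inputs: published facts by name, Pollack–Rubin, modularity, the partner data, the `L`-value, and `hMT`.
PER PAIR; CONDITIONAL on `hMT`; closes nothing. [cite: PollackRubin2004, Theorem (p. 448) = Thm. 7.3]
[cite: Kurihara2002, Thm. 0.1] [cite: GreenbergVatsal2000, Thm. (1.4) and §3 Remark 3.4] -/
theorem kobayashiMainConjecture_of_mazurTate_congr_of_cmPartner_of_lvalue
    {W : WeierstrassCurve ℚ} [W.IsElliptic] [W.IsGloballyMinimal]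
    (h12 : Kobayashi2003.thm12_signedSelmerDual_finite_torsion)
    (h41 : Kobayashi2003.thm41_signedCharIdeal_divisibility)
    (h5 : realPeriodRat_eq_unit_mul_plusPeriod) (h3 : realPeriodRat_eq_unit_mul_plusPeriod_three)
    (h09 : cor213_signedMu_eq_zero_iff_of_torsionIso)
    (hKim : BDKim2009.cor213_signedLambda_add_sum_delta_eq_of_torsionIso)
    (hPR : PollackRubin2004.mainTheorem_signedCharIdeal_eq_of_cm)
    (hmod : nonempty_modularParametrizationData)
    (hp2 : p ≠ 2) (hgood : W.HasGoodReductionAtPrime p) (hap : W.frobeniusTrace p = 0) (ε : ℤˣ)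
    [NeZero (W.conductorNorm ℤ)] {f₀ : CuspForm (Gamma0 (W.conductorNorm ℤ)) 2} (hf₀ : IsNewformOf W f₀)
    {W' : WeierstrassCurve ℚ} [W'.IsElliptic] [W'.IsGloballyMinimal]
    (hcm' : W'.HasCM) (hss' : GoodSS W' p) (hap' : W'.frobeniusTrace p = 0)
    (he : ∃ e : geomTorsion W (p : ℤ) ≃+ geomTorsion W' (p : ℤ),
      ∀ (σ : Field.absoluteGaloisGroup ℚ) (P : geomTorsion W (p : ℤ)), e (σ • P) = σ • e P)
    [NeZero (W'.conductorNorm ℤ)] {f₀' : CuspForm (Gamma0 (W'.conductorNorm ℤ)) 2}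
    (hf₀' : IsNewformOf W' f₀') {q : ℚ} (hq0 : q ≠ 0)
    (hLval : W'.entireLFunction 1 / (W'.realPeriodRat : ℂ) = (q : ℂ)) (hv : padicValRat p q = 0)
    (S₀ : Finset (HeightOneSpectrum (𝓞 ℚ))) (hS₀ : ∀ v ∈ S₀, ((p : ℕ) : 𝓞 ℚ) ∉ v.asIdeal)
    (hS₀W : ∀ v : HeightOneSpectrum (𝓞 ℚ), ¬ W.HasGoodReductionAt v → v ∈ S₀)
    (hS₀W' : ∀ v : HeightOneSpectrum (𝓞 ℚ), ¬ W'.HasGoodReductionAt v → v ∈ S₀)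
    {c : ℤ_[p]} (hc : IsUnit c)
    (hMT : ∀ n : ℕ, ∃ q r : IwasawaAlgebra p,
      ((mazurTateElement f₀ p n).map (algebraMap ℚ ℚ_[p]) : PowerSeries ℚ_[p]) *
            iwasawaToPowerSeries p (eulerFactorProduct W p S₀) -
          iwasawaToPowerSeries p (PowerSeries.C c) *
            (((mazurTateElement f₀' p n).map (algebraMap ℚ ℚ_[p]) : PowerSeries ℚ_[p]) *
              iwasawaToPowerSeries p (eulerFactorProduct W' p S₀)) =
        iwasawaToPowerSeries p
          (toIwasawa p (cyclotomicOmega p n) * q + PowerSeries.C (p : ℤ_[p]) * r)) :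
    KobayashiMainConjecture W p ε :=
  kobayashiMainConjecture_of_mazurTate_congr_of_cmPartner h12 h41 h5 h3 h09 hKim hPR hmod hp2 hgood hap ε hf₀
    hcm' hss' hap' he hf₀' (mu_signed_eq_zero_of_lvalue h5 h3 hp2 hss'.1 hap' hq0 hLval hv hf₀' ε) S₀ hS₀
    hS₀W hS₀W' hc hMT

end Summit.BirchSwinnertonDyer.BirchSwinnertonDyer.Theorems.SmallImageAnalyticTransferRoad

end
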